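/-
Copyright (c) 2026. All rights reserved.
Released under Apache 2.0 license as described in the file LICENSE.
Authors: abc-iut cell — seat abc-iut-w6-d024 (gen 4; block C / W6, L4-lead RULING #8h row «COR27e-ORBI-TRANSPORT»,
part (B): the (c) ↔ planar junction at a GENUINE punctured elliptic curve).  PROOF-ONLY — no definitions.
Consumes abc-iut-w6-d031's genuine group-law package (p439414 / `existsUnique_groupLaw_of_isPuncturedEllipticCurve`)
and abc-iut-L4-t8's existence (p437372) BY NAME.
-/
import Literature.AnabelianGeometry.AbsoluteAnabelian.HolomorphicEllipticCuspidalizationGenuineGroupLawUnique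
import Mathlib.Geometry.Manifold.MFDeriv.Atlas
import HarnessLib

/-!
# [AbsTopIII] Cor 2.7 (c)/(e): the local additive structure of the genuine group law is PLANAR in a
# holomorphic chart (the junction between the genuine `𝔼` and the germ model of Prop 2.6)

S. Mochizuki, *Topics in absolute anabelian geometry III* (bib key `MochizukiAbsTopIII2015`), Cor 2.7 (c)
(kurims p.59 l.15–20): "one may construct the group structure on [the one-point compactification of]
`E^top` [that arises from the elliptic curve determined by `E`] … This group structure determines 'local
additive structures' [cf. Proposition 2.5, (e)] at the various points of `E^top`", and (e) (p.60 l.2–7):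
"`𝒜_p` … compatible with the 'local additive structures' of (c)".

The germ model of Prop 2.6 / Cor 2.7 (e) (abc-iut-w4-d104 `germAut`; abc-iut-w6-d024 `germAutFromAutHol`,
`cor27eGermAutFromAutHol_holds`, p437330/p440390) reads "compatible with the local additive structure" as
`LocGerm.IsAddCompat` — additivity for the PLANAR structure `a +_p b := a + b − p` of a chart.  This
PROOF-ONLY file supplies the junction with the GENUINE object: for a punctured elliptic curve `E` in the
typed sense, carrying the group law of (c) — abc-iut-L4-t8's existence p437372 / abc-iut-w6-d031's
uniqueness `existsUnique_groupLaw_of_isPuncturedEllipticCurve` (p439414): a commutative topological group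
law on `OnePoint E` with `∞ = 0` and an isomorphism of topological groups `ψ : OnePoint E ≃ₜ+ ℂ/Φ(ℤ²)`
holomorphic on `E` — the composite `κ := chart_Φ ∘ ψ` of `ψ` with a chart of the complex torus is a
HOLOMORPHIC chart of `E` near `p` in which the local additive structure of (c) IS the planar one:

* `Cor27c.chart_symm_add_sub`, `Cor27c.chart_add_sub`, `Cor27c.eventually_chart_add_sub` — the charts
  `ComplexTorus.chart Φ a` of the tree's complex torus linearise the group law: their inverse is the
  additive map `z ↦ proj (Φ⁻¹ z)`, so `chart (t₁ + t₂ − t₀) = chart t₁ + chart t₂ − chart t₀` near `t₀`;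
* `Cor27c.eventually_add_sub_mem_range_coe` — near `p ∈ E` the (c)-sum `a +_p b = a + b − p` (computed in
  `OnePoint E`) stays in `E`;
* `Cor27c.eventually_localAdd_chart` — **the junction**: `κ (a +_p b) = κ a + κ b − κ p` for `(a, b)` near
  `(p, p)`;
* `Cor27c.mdifferentiableAt_chart_comp` — `κ` is holomorphic on `E` near `p` (`ψ|_E` holomorphic, torus
  charts holomorphic: Mathlib `mdifferentiableAt_atlas`);
* `Cor27c.localAdd_planar_of_isPuncturedEllipticCurve` — assembled at every typed punctured elliptic
  curve from `existsUnique_groupLaw_of_isPuncturedEllipticCurve`.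

So at a genuine `𝔼` the hypothesis «compatible with the local additive structures of (c)» of (e), read in
the holomorphic coordinate `κ`, is exactly the planar `IsAddCompat` of the germ model — the standing
assumption of the MODEL-LEVEL discharge p440390.  What is NOT here: the identification of the
Aut-holomorphic structure of a small disc `U ⊆ E` with that of its planar picture `κ(U)` (transport of
`holAut` along the biholomorphic `κ`, abc-iut-L4-t2/t7's `AutHolomorphicSpacesTransportProofs` pattern) —
the remaining step to state (e) verbatim at `𝔼`.  Refereed pre-IUT material; nothing here bears on the
disputed [IUTchIII] Cor. 3.12; typed ≠ endorsed.
-/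

noncomputable section

namespace Literature.AnabelianGeometry.AbsoluteAnabelian

namespace Cor27c

open _root_.TopologicalSpace _root_.Topology _root_.Set _root_.Function _root_.Filter _root_.OnePoint
open scoped _root_.Manifold _root_.ContDiff
open Literature.Geometry.Kaehler (ComplexTorus)
open Literature.Geometry.Kaehler.ComplexTorus (chart proj chart_symm_apply)

/-! ### The torus charts linearise the group law -/

section Torus

variable {ι : Type} [Fintype ι] {Φ : (ι → ℝ) ≃L[ℝ] ℂ}

/-- The inverse torus chart `z ↦ proj (Φ⁻¹ z)` is additive: it carries `z₁ + z₂ − z₀` to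
`t₁ + t₂ − t₀`. [cite: MochizukiAbsTopIII2015, Corollary 2.7 (c) p.59] -/
theorem chart_symm_add_sub (a : ι → ℝ) (z₁ z₂ z₀ : ℂ) :
    (chart Φ a).symm (z₁ + z₂ - z₀) =
      (chart Φ a).symm z₁ + (chart Φ a).symm z₂ - (chart Φ a).symm z₀ := by
  simp only [chart_symm_apply, map_add, map_sub]
  rfl

/-- **A torus chart linearises the group law**: if `t₁, t₂, t₀` lie in the domain of `chart Φ a` and
`chart t₁ + chart t₂ − chart t₀` lies in its target, then `t₁ + t₂ − t₀` lies in the domain and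
`chart (t₁ + t₂ − t₀) = chart t₁ + chart t₂ − chart t₀`. [cite: MochizukiAbsTopIII2015, Corollary 2.7 (c) p.59] -/
theorem chart_add_sub (a : ι → ℝ) {t₁ t₂ t₀ : ComplexTorus Φ} (h₁ : t₁ ∈ (chart Φ a).source)
    (h₂ : t₂ ∈ (chart Φ a).source) (h₀ : t₀ ∈ (chart Φ a).source)
    (ht : chart Φ a t₁ + chart Φ a t₂ - chart Φ a t₀ ∈ (chart Φ a).target) :
    t₁ + t₂ - t₀ ∈ (chart Φ a).source ∧
      chart Φ a (t₁ + t₂ - t₀) = chart Φ a t₁ + chart Φ a t₂ - chart Φ a t₀ := by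
  have key : (chart Φ a).symm (chart Φ a t₁ + chart Φ a t₂ - chart Φ a t₀) = t₁ + t₂ - t₀ := by
    rw [chart_symm_add_sub, (chart Φ a).left_inv h₁, (chart Φ a).left_inv h₂, (chart Φ a).left_inv h₀]
  refine ⟨?_, ?_⟩
  · rw [← key]; exact (chart Φ a).map_target ht
  · rw [← key, (chart Φ a).right_inv ht]

/-- Near `(t₀, t₀)` the linearisation holds unconditionally (domains and targets of charts are open).
[cite: MochizukiAbsTopIII2015, Corollary 2.7 (c) p.59] -/
theorem eventually_chart_add_sub (a : ι → ℝ) {t₀ : ComplexTorus Φ} (h₀ : t₀ ∈ (chart Φ a).source) :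
    ∀ᶠ tt : ComplexTorus Φ × ComplexTorus Φ in 𝓝 (t₀, t₀),
      tt.1 + tt.2 - t₀ ∈ (chart Φ a).source ∧
        chart Φ a (tt.1 + tt.2 - t₀) = chart Φ a tt.1 + chart Φ a tt.2 - chart Φ a t₀ := by
  have hs : (chart Φ a).source ∈ 𝓝 t₀ := (chart Φ a).open_source.mem_nhds h₀
  have h1 : ∀ᶠ tt : ComplexTorus Φ × ComplexTorus Φ in 𝓝 (t₀, t₀), tt.1 ∈ (chart Φ a).source :=
    continuousAt_fst.eventually (by exact hs)
  have h2 : ∀ᶠ tt : ComplexTorus Φ × ComplexTorus Φ in 𝓝 (t₀, t₀), tt.2 ∈ (chart Φ a).source :=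
    continuousAt_snd.eventually (by exact hs)
  have hc : ContinuousAt (fun tt : ComplexTorus Φ × ComplexTorus Φ =>
      chart Φ a tt.1 + chart Φ a tt.2 - chart Φ a t₀) (t₀, t₀) := by
    have hca : ContinuousAt (chart Φ a) t₀ := (chart Φ a).continuousAt h₀
    exact ((hca.comp continuousAt_fst).add (hca.comp continuousAt_snd)).sub continuousAt_const
  have ht : (chart Φ a).target ∈ 𝓝 (chart Φ a t₀ + chart Φ a t₀ - chart Φ a t₀) := by
    rw [add_sub_cancel_right]
    exact (chart Φ a).open_target.mem_nhds ((chart Φ a).map_source h₀)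
  have h3 := hc.eventually (show ∀ᶠ z in 𝓝 (chart Φ a t₀ + chart Φ a t₀ - chart Φ a t₀),
    z ∈ (chart Φ a).target from ht)
  filter_upwards [h1, h2, h3] with tt htt1 htt2 htt3
  exact chart_add_sub a htt1 htt2 h₀ htt3

end Torus

/-! ### The genuine punctured elliptic curve -/

section Genuine

variable {E : Type} [TopologicalSpace E] [AddCommGroup (OnePoint E)] [IsTopologicalAddGroup (OnePoint E)]
  {ι : Type} [Fintype ι] {Φ : (ι → ℝ) ≃L[ℝ] ℂ}

/-- Near `p ∈ E` the (c)-sum `a +_p b = a + b − p`, computed in the one-point compactification with its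
group law, stays in `E` (it tends to `p ≠ ∞`, and `E ⊆ OnePoint E` is open).
[cite: MochizukiAbsTopIII2015, Corollary 2.7 (c) p.59] -/
theorem eventually_add_sub_mem_range_coe (p : E) :
    ∀ᶠ ab : E × E in 𝓝 (p, p),
      ((ab.1 : OnePoint E) + ab.2 - p) ∈ range ((↑) : E → OnePoint E) := by
  have hc : ContinuousAt (fun ab : E × E => ((ab.1 : OnePoint E) + ab.2 - p)) (p, p) :=
    ((continuous_coe.continuousAt.comp continuousAt_fst).add
      (continuous_coe.continuousAt.comp continuousAt_snd)).sub continuousAt_const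
  have hmem : range ((↑) : E → OnePoint E) ∈ 𝓝 (((p : OnePoint E) + p - p)) := by
    rw [add_sub_cancel_right]
    exact OnePoint.isOpen_range_coe.mem_nhds (mem_range_self p)
  exact hc.eventually (show ∀ᶠ z in 𝓝 ((p : OnePoint E) + p - p), z ∈ range ((↑) : E → OnePoint E)
    from hmem)

omit [IsTopologicalAddGroup (OnePoint E)] in
/-- **The junction**: for `ψ : OnePoint E ≃ₜ+ ℂ/Φ(ℤ²)` (the group law of (c) transported to the complex
torus it determines) and a torus chart at `ψ p`, the coordinate `κ := chart ∘ ψ` LINEARISES the local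
additive structure of (c) at `p`: `κ (a +_p b) = κ a + κ b − κ p` for `(a, b)` near `(p, p)` — the planar
structure `a + b − p` of Prop 2.5 (e) / the germ model. [cite: MochizukiAbsTopIII2015, Corollary 2.7 (c) p.59] -/
theorem eventually_localAdd_chart (ψ : OnePoint E ≃ₜ+ ComplexTorus Φ) (p : E) (a : ι → ℝ)
    (ha : ψ p ∈ (chart Φ a).source) :
    ∀ᶠ ab : E × E in 𝓝 (p, p),
      chart Φ a (ψ ((ab.1 : OnePoint E) + ab.2 - p)) =
        chart Φ a (ψ ab.1) + chart Φ a (ψ ab.2) - chart Φ a (ψ p) := by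
  have hT := eventually_chart_add_sub a ha
  have hc : ContinuousAt (fun ab : E × E => (ψ (ab.1 : OnePoint E), ψ (ab.2 : OnePoint E))) (p, p) :=
    ((ψ.continuous.comp continuous_coe).continuousAt.comp continuousAt_fst).prodMk
      ((ψ.continuous.comp continuous_coe).continuousAt.comp continuousAt_snd)
  have h := hc.eventually hT
  filter_upwards [h] with ab hab
  rw [map_sub, map_add]
  exact hab.2

omit [IsTopologicalAddGroup (OnePoint E)] in
/-- The same junction in the PREFERRED chart of the complex torus at `ψ p` (Mathlib's `chartAt`).
[cite: MochizukiAbsTopIII2015, Corollary 2.7 (c) p.59] -/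
theorem eventually_localAdd_chartAt (ψ : OnePoint E ≃ₜ+ ComplexTorus Φ) (p : E) :
    ∀ᶠ ab : E × E in 𝓝 (p, p),
      chartAt ℂ (ψ p) (ψ ((ab.1 : OnePoint E) + ab.2 - p)) =
        chartAt ℂ (ψ p) (ψ ab.1) + chartAt ℂ (ψ p) (ψ ab.2) - chartAt ℂ (ψ p) (ψ p) :=
  eventually_localAdd_chart ψ p _ (mem_chart_source ℂ (ψ (p : OnePoint E)))

omit [AddCommGroup (OnePoint E)] [IsTopologicalAddGroup (OnePoint E)] in
/-- The coordinate `κ := chart ∘ ψ` is HOLOMORPHIC on `E` wherever defined (`ψ|_E` holomorphic; the torus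
charts belong to the holomorphic atlas). [cite: MochizukiAbsTopIII2015, Corollary 2.7 (c) p.59] -/
theorem mdifferentiableAt_chart_comp [ChartedSpace ℂ E] {ψ : OnePoint E → ComplexTorus Φ}
    (hψ : MDifferentiable 𝓘(ℂ, ℂ) 𝓘(ℂ, ℂ) (fun x : E => ψ x)) (a : ι → ℝ) {x : E}
    (hx : ψ x ∈ (chart Φ a).source) :
    MDifferentiableAt 𝓘(ℂ, ℂ) 𝓘(ℂ, ℂ) (fun y : E => chart Φ a (ψ y)) x := by
  have hatlas : chart Φ a ∈ atlas ℂ (ComplexTorus Φ) := by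
    rw [Literature.Geometry.Kaehler.ComplexTorus.atlas_eq]; exact ⟨a, rfl⟩
  exact (mdifferentiableAt_atlas (I := 𝓘(ℂ, ℂ)) hatlas hx).comp x (hψ x)

end Genuine

/-! ### Assembly at every typed punctured elliptic curve -/

/-- **[AbsTopIII] Cor 2.7 (c) ↔ planar, at the GENUINE object**: for every punctured elliptic curve `E`
in the typed sense, THE group law of (c) on `OnePoint E` (abc-iut-L4-t8 existence p437372, abc-iut-w6-d031
uniqueness `existsUnique_groupLaw_of_isPuncturedEllipticCurve`) admits, at every `p ∈ E`, a coordinate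
`κ : E → ℂ`, holomorphic near `p`, in which its local additive structure is the planar one:
`a +_p b ∈ E` and `κ (a +_p b) = κ a + κ b − κ p` for `(a, b)` near `(p, p)`.
[cite: MochizukiAbsTopIII2015, Corollary 2.7 (c) p.59] -/
theorem localAdd_planar_of_isPuncturedEllipticCurve (E : Type) [TopologicalSpace E] [T2Space E]
    [ChartedSpace ℂ E] [IsManifold 𝓘(ℂ, ℂ) ω E]
    (hE : TorsionPointsDenseUniqueGroupLaw.IsPuncturedEllipticCurve E) :
    ∃ g : AddCommGroup (OnePoint E),
      (letI : AddCommGroup (OnePoint E) := g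
       IsTopologicalAddGroup (OnePoint E) ∧ (∞ : OnePoint E) = 0 ∧
       ∀ p : E, ∃ κ : E → ℂ, (∀ᶠ x in 𝓝 p, MDifferentiableAt 𝓘(ℂ, ℂ) 𝓘(ℂ, ℂ) κ x) ∧
         ∀ᶠ ab : E × E in 𝓝 (p, p),
           ((ab.1 : OnePoint E) + ab.2 - p) ∈ range ((↑) : E → OnePoint E) ∧
           ∀ c : E, (c : OnePoint E) = (ab.1 : OnePoint E) + ab.2 - p → κ c = κ ab.1 + κ ab.2 - κ p) := by
  obtain ⟨g, ⟨htop, h0, Φ, ψ, hψ⟩, -⟩ :=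
    HolomorphicEllipticCuspidalization.existsUnique_groupLaw_of_isPuncturedEllipticCurve hE
  letI : AddCommGroup (OnePoint E) := g
  haveI : IsTopologicalAddGroup (OnePoint E) := htop
  refine ⟨g, htop, h0, fun p => ?_⟩
  set a : Fin 2 → ℝ := Literature.Geometry.Kaehler.ComplexTorus.corner Φ (ψ p) with hadef
  have ha : ψ p ∈ (chart Φ a).source := mem_chart_source ℂ (ψ (p : OnePoint E))
  refine ⟨fun x : E => chart Φ a (ψ x), ?_, ?_⟩
  · -- holomorphic near `p`: `ψ x` stays in the chart domain
    have hopen : ∀ᶠ x : E in 𝓝 p, ψ x ∈ (chart Φ a).source :=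
      (ψ.continuous.comp continuous_coe).continuousAt.eventually
        ((chart Φ a).open_source.mem_nhds (by exact ha))
    filter_upwards [hopen] with x hx
    exact mdifferentiableAt_chart_comp hψ a hx
  · filter_upwards [eventually_add_sub_mem_range_coe p, eventually_localAdd_chart ψ p a ha] with ab h1 h2
    refine ⟨h1, fun c hc => ?_⟩
    rw [hc]
    exact h2

end Cor27c

end Literature.AnabelianGeometry.AbsoluteAnabelian

end
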